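import Summits.BirchSwinnertonDyer.BirchSwinnertonDyer.Theses.SignedLowerHalves
import Summits.BirchSwinnertonDyer.BirchSwinnertonDyer.Theorems.SignedLowerHalvesKobayashiLowerHalfLargeImageMuFloorSupply
import HarnessLib

/-!
# Route `SignedLowerHalves`, crux 3 `KobayashiLowerHalfLargeImage` (item stmt-BirchSwinnertonDyer-19001):
# the line sketch `horocycle_mu_floor` composed with its μ-half SUPPLIED BY THE TREE —
# crux 3 BY NAME ⟸ {λ-part with `p` inverted for both signs, Conjecture B⁰, period unit, μ-upgrade algebra}
# (cell `bsd-ssimc`, width seat `bsd-line-slh-p1-w6` gen 0; `--supports 19001`; CALIBRATION ONLY; imports the route file)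

HONEST FRAMING.  The crux is OPEN and nothing here proves it; BSD is not proved by any of this.  This is the
unregistered line sketch's own composition `HorocycleMuFloor.KobayashiLowerHalfLargeImage_of_horocycleMuFloor`
(`Cruxes/KobayashiLowerHalfLargeImage/Lines/horocycle_mu_floor.lean`, k2 g16; 0 sorries there, hypotheses as
binders) with its FIVE μ-binders `HorocycleGenerationAll`, `ReductionAtThree`, `DescentStabilisation`,
`MuFloorResidualGeFive`, `NewformExists` REPLACED by the single binder Conjecture B⁰ `TeichSpanGenAll` (OPEN; cell
`bsd-f3-mu`; used only at `p ≥ 5`) — because the μ-floor is input-free at `p = 3` and is B⁰ by name at `p ≥ 5`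
(`Theorems/…LargeImageMuFloorSupply.lean`, `LargeImageMuFloor.signedMuFloor_of_teichSpanGenAll`).  The remaining
binders are the line's, VERBATIM (with the line's `MuZero` spelled as the tree's `HasUnitContent`, same body):
`hlam` = the λ-part with `p` inverted for both signs (the line's `LambdaLowerDivisibility W p ε`; EXTERNAL — affinoid-
eisenstein S1–S3 or a rational signed main conjecture; OPEN), `hperiod` = the line's `PeriodUnit W p` (in print:
Mazur's Manin constant / Greenberg–Vatsal periods; the tree's `padicValRat_periodRatio_eq_zero` road, width seat w2 g5),
`halg` = the line's `MuUpgrade p` (pure `Λ`-algebra; width seat w2 g5).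

So, as a statement about item 19001: **line `horocycle_mu_floor` = «λ-part (external, OPEN) + B⁰ at `p ≥ 5`»**; at the
`p = 3` pairs of X7 it adds NOTHING to the λ-part.  CALIBRATION / SUPPORT ONLY (pen rule D34-4 (3)): never an input to
a registered stub, a `closes`, or a by-name close of the item (line of record: `kurihara_rigidity`).

References: [Pollack2003] Prop. 6.18; [Kobayashi2003] Thm. 3.2, Conjecture (p. 2); [PollackWeston2011] Thm. 4.1 (1);
[Vaserstein1972SL2] Theorem; [Manin1972] Prop. 1.4.
-/

-- D-0017: single-problem summit, the namespace repeats the problem name by design.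
set_option linter.dupNamespace false
set_option autoImplicit false

noncomputable section

open scoped Classical MatrixGroups ModularForm

open CongruenceSubgroup WeierstrassCurve Literature.NumberTheory.EllipticCurves
  Literature.NumberTheory.EllipticCurves.ModularForms
  Literature.NumberTheory.EllipticCurves.Kobayashi2003 Literature.NumberTheory.EllipticCurves.GreenbergVatsal2000
  Literature.NumberTheory.EllipticCurves.Rank1Residual ZpExtension
  Summit.BirchSwinnertonDyer.Rank1Residual.Supersingular

namespace Summit.BirchSwinnertonDyer.BirchSwinnertonDyer.Theorems.LargeImageMuFloorCrux

open Summit.BirchSwinnertonDyer.BirchSwinnertonDyer.Cruxes.AnalyticMuZeroX9.TeichSpan (TeichSpanGenAll)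
open Summit.BirchSwinnertonDyer.BirchSwinnertonDyer.Theorems.LargeImageMuFloor (signedMuFloor_of_teichSpanGenAll)

/-- **Crux 3 BY NAME from the horocycle line's binders with the μ-half supplied by the tree.**  Hypotheses (all
displayed; the first three are the line sketch's `hlam`, `hperiod`, `halg` VERBATIM up to `MuZero ↦ HasUnitContent`):
`hlam` — the λ-part with `p` inverted, both signs, on the crux's class (`ι(p^m·g) = ϖ·ι(L^ε·h)` for a generator `g` of
`char X^ε`; EXTERNAL, OPEN); `hperiod` — the period ratio `ϖ = Ω⁺_f/Ω_W` is a `p`-unit on X7 ∧ Surj (in print);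
`halg` — the μ-upgrade (`p` prime in `ℤ_p⟦T⟧`: a `Λ[1/p]`-divisibility by `ϖ·L` with `μ(L) = 0`, `ϖ` a unit, is a
`Λ`-divisibility; pure algebra); `hB` — Conjecture B⁰ `TeichSpanGenAll` (OPEN; used only at `p ≥ 5`).  Conclusion: the
route decl `SignedLowerHalves.KobayashiLowerHalfLargeImage`.  Proof = the line's composition with
`LargeImageMuFloor.signedMuFloor_of_teichSpanGenAll` in place of `signedMuFloorW_of_horocycle`.  CALIBRATION ONLY.
[cite: Kobayashi2003, Conjecture (Main Conjecture) (p. 2)] [cite: PollackWeston2011, Thm. 4.1 (1)] [cite: Vaserstein1972SL2, Theorem] -/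
theorem kobayashiLowerHalfLargeImage_of_lambdaPart_of_teichSpanGenAll
    (hlam : ∀ (W : WeierstrassCurve ℚ) [W.IsElliptic] [W.IsGloballyMinimal] (p : ℕ) [Fact p.Prime],
      p ≠ 2 → ClassX7 W p → ¬ W.HasCM → W.frobeniusTrace p = 0 → Surj W p → ∀ ε : ℤˣ,
      ∀ (κ : ZpExtension ℚ p) (γ : Field.absoluteGaloisGroup ℚ),
          κ.IsCyclotomic → κ.IsTopGenerator γ → IsCyclotomicVariable p γ →
        ∀ [NeZero (W.conductorNorm ℤ)] (f : CuspForm (Gamma0 (W.conductorNorm ℤ)) 2),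
          IsNewformOf W f → ∀ (ϖ : ℚ), (ϖ : ℝ) * W.realPeriodRat = plusPeriod f →
        ∀ (Lplus Lminus : IwasawaAlgebra p), IsPollackPair f p Lplus Lminus →
        ∀ (D : SignedSelmerDualData W κ γ ε),
          ∃ (g h : IwasawaAlgebra p) (m : ℕ), D.charIdeal = Ideal.span {g} ∧
            iwasawaToPowerSeries p (PowerSeries.C ((p : ℤ_[p]) ^ m) * g) =
              PowerSeries.C (ϖ : ℚ_[p]) * iwasawaToPowerSeries p (kobayashiL ε Lplus Lminus * h))
    (hperiod : ∀ (W : WeierstrassCurve ℚ) [W.IsElliptic] [W.IsGloballyMinimal] (p : ℕ) [Fact p.Prime],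
      p ≠ 2 → ClassX7 W p → Surj W p →
      ∀ [NeZero (W.conductorNorm ℤ)] (f : CuspForm (Gamma0 (W.conductorNorm ℤ)) 2),
        IsNewformOf W f → ∀ ϖ : ℚ, (ϖ : ℝ) * W.realPeriodRat = plusPeriod f → padicValRat p ϖ = 0)
    (halg : ∀ (p : ℕ) [Fact p.Prime] (ϖ : ℚ) (L g h : IwasawaAlgebra p) (m : ℕ),
      padicValRat p ϖ = 0 → HasUnitContent L →
      iwasawaToPowerSeries p (PowerSeries.C ((p : ℤ_[p]) ^ m) * g) =
        PowerSeries.C (ϖ : ℚ_[p]) * iwasawaToPowerSeries p (L * h) →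
      ∃ h' : IwasawaAlgebra p,
        iwasawaToPowerSeries p g = PowerSeries.C (ϖ : ℚ_[p]) * iwasawaToPowerSeries p (L * h'))
    (hB : TeichSpanGenAll) :
    Summit.BirchSwinnertonDyer.BirchSwinnertonDyer.Theses.SignedLowerHalves.KobayashiLowerHalfLargeImage := by
  intro W _ _ p _ hp hX7 hCM hap hS
  obtain ⟨ε, hε⟩ := signedMuFloor_of_teichSpanGenAll (W := W) hB hp hX7.1.1 hap
  refine ⟨ε, ?_⟩
  intro κ γ hκ hγ hγ' _ f hf ϖ hϖ Lplus Lminus hL D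
  obtain ⟨g, h, m, hg, hι⟩ :=
    hlam W p hp hX7 hCM hap hS ε κ γ hκ hγ hγ' f hf ϖ hϖ Lplus Lminus hL D
  have hmu : HasUnitContent (kobayashiL ε Lplus Lminus) := hε f hf Lplus Lminus hL
  have hunit : padicValRat p ϖ = 0 := hperiod W p hp hX7 hS f hf ϖ hϖ
  obtain ⟨h', hh'⟩ := halg p ϖ (kobayashiL ε Lplus Lminus) g h m hunit hmu hι
  exact ⟨g, h', hg, hh'⟩

/-- **The `p = 3` rows: crux 3's conclusion from the λ-part, the period unit and the μ-upgrade ALONE** (no B⁰, no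
(Conn)): for `W/ℚ` globally minimal with good reduction at `p = 3` and `a₃ = 0` (the X7 / non-CM / onto hypotheses of
the crux are not even needed for this composition), `∃ ε, KobayashiLowerDivisibility W 3 ε` GRANTED the three
displayed binders at that pair.  Per-pair form.
[cite: Kobayashi2003, Conjecture (Main Conjecture) (p. 2)] [cite: Vaserstein1972SL2, Theorem] -/
theorem exists_kobayashiLowerDivisibility_three_of_lambdaPart
    (W : WeierstrassCurve ℚ) [W.IsElliptic] [W.IsGloballyMinimal] (p : ℕ) [Fact p.Prime] (hp3 : p = 3)
    (hgood : W.HasGoodReductionAtPrime p) (hap : W.frobeniusTrace p = 0)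
    (hlam : ∀ ε : ℤˣ, ∀ (κ : ZpExtension ℚ p) (γ : Field.absoluteGaloisGroup ℚ),
          κ.IsCyclotomic → κ.IsTopGenerator γ → IsCyclotomicVariable p γ →
        ∀ [NeZero (W.conductorNorm ℤ)] (f : CuspForm (Gamma0 (W.conductorNorm ℤ)) 2),
          IsNewformOf W f → ∀ (ϖ : ℚ), (ϖ : ℝ) * W.realPeriodRat = plusPeriod f →
        ∀ (Lplus Lminus : IwasawaAlgebra p), IsPollackPair f p Lplus Lminus →
        ∀ (D : SignedSelmerDualData W κ γ ε),
          ∃ (g h : IwasawaAlgebra p) (m : ℕ), D.charIdeal = Ideal.span {g} ∧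
            iwasawaToPowerSeries p (PowerSeries.C ((p : ℤ_[p]) ^ m) * g) =
              PowerSeries.C (ϖ : ℚ_[p]) * iwasawaToPowerSeries p (kobayashiL ε Lplus Lminus * h))
    (hperiod : ∀ [NeZero (W.conductorNorm ℤ)] (f : CuspForm (Gamma0 (W.conductorNorm ℤ)) 2),
        IsNewformOf W f → ∀ ϖ : ℚ, (ϖ : ℝ) * W.realPeriodRat = plusPeriod f → padicValRat p ϖ = 0)
    (halg : ∀ (ϖ : ℚ) (L g h : IwasawaAlgebra p) (m : ℕ),
      padicValRat p ϖ = 0 → HasUnitContent L →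
      iwasawaToPowerSeries p (PowerSeries.C ((p : ℤ_[p]) ^ m) * g) =
        PowerSeries.C (ϖ : ℚ_[p]) * iwasawaToPowerSeries p (L * h) →
      ∃ h' : IwasawaAlgebra p,
        iwasawaToPowerSeries p g = PowerSeries.C (ϖ : ℚ_[p]) * iwasawaToPowerSeries p (L * h')) :
    ∃ ε : ℤˣ, KobayashiLowerDivisibility W p ε := by
  obtain ⟨ε, hε⟩ := LargeImageMuFloor.signedMuFloor_three (W := W) p hp3 hgood hap
  refine ⟨ε, ?_⟩
  intro κ γ hκ hγ hγ' _ f hf ϖ hϖ Lplus Lminus hL D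
  obtain ⟨g, h, m, hg, hι⟩ := hlam ε κ γ hκ hγ hγ' f hf ϖ hϖ Lplus Lminus hL D
  obtain ⟨h', hh'⟩ := halg ϖ (kobayashiL ε Lplus Lminus) g h m (hperiod f hf ϖ hϖ) (hε f hf Lplus Lminus hL) hι
  exact ⟨g, h', hg, hh'⟩

end Summit.BirchSwinnertonDyer.BirchSwinnertonDyer.Theorems.LargeImageMuFloorCrux

end
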